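import Literature.NumberTheory.GelbartRogawski1991.UnitaryDualPairThetaKernelCMTwistDet
import Literature.NumberTheory.Automorphic.UnitaryGroupAdelicCenterRational
import Literature.NumberTheory.Automorphic.UnitaryGroupArchCenter
import Literature.NumberTheory.Automorphic.UnitaryGroupAdelicProduct
import Literature.NumberTheory.Automorphic.UnitaryGroupAdelicLineTorus
import Literature.NumberTheory.Automorphic.RelNormOneTorusInfPart
import Mathlib.Topology.Algebra.PontryaginDual
import HarnessLib

/-!
# Automorphic characters of `[U(1)] = ker N_{L/L⁺}(𝔸) ⧸ L¹` from characters of the FINITE centre `u_f ↦ u_f · 1_N`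

Topic `NumberTheory/Automorphic`; namespace `Literature.NumberTheory.Automorphic.UnitaryGroup` (CM currency of
`UnitaryGroupAdelicCenterRational` §CM, `UnitaryGroupArchCenter` §CM).  KERNEL ONLY: two definitions with bodies
(`cmCentreFinChar`, `cmCentreFinCharQuot`) and proved theorems; nothing asserted.

[Liu2021, Def. 4.11 (l. 2090)] indexes the theta lifts by characters `χ` of the FINITE quotient `L¹ \ (𝔸_L^∞)¹`
(the tree's `Liu2021.Def411WeilCarriers.Chi`: continuous characters of `U(1)(𝔸_{L⁺,f})` trivial on `L¹`), while the theta
integral `∫_{[U(W)]} θ(g,h) χ(h) dh` ([Liu2021, proof of Prop. 4.13 (l. 2145)]; the tree's `ThetaKernelDatum.thetaLift` over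
`relNormOneIdeles ⧸ relNormOneRat`) wants a character of the FULL adelic quotient `[U(1)] = U(1)(L⁺)\U(1)(𝔸_{L⁺})`.  The passage is
the standard one — extend by `1` at the archimedean place — and this file performs it in the tree's currencies, for a character `ψ`
of the finite-adelic points `U(J)(𝔸_{L⁺,f})` of ANY hermitian space read on the centre:

* §1 `cmCentreFinChar ψ : ker N_{L/L⁺}(𝔸) →* ℂˣ`, `t ↦ ψ((t · 1_N)_f)` (centre `adelicCenter`, finite part `finPart`, currency
  `cmAdelicOneEquivRelNormOne`); it is TRIVIAL on the archimedean torus `(y, 1)` (`cmCentreFinChar_relNormOneInfToIdeles`, ★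
  `archToAdelic_cmArchCenter`), trivial on the rational points `L¹ = relNormOneRat` as soon as `ψ` is trivial on the finite parts of
  the rational points `U(J)(L⁺)` (`cmCentreFinChar_eq_one_of_mem_relNormOneRat`, ★ `cm_adelicCenter_symm_mem_range_toAdelic`), and
  continuous when `ψ` is;
* §2 **`cmCentreFinCharQuot ψ … : PontryaginDual (relNormOneIdeles ⧸ relNormOneRat)`** — the descended continuous unitary character
  `χ̃` for `ψ` continuous, unitary and trivial on `U(J)(L⁺)`: `χ̃([t]) = ψ((t · 1_N)_f)` (`coe_cmCentreFinCharQuot_mk`), `χ̃([(y,1)]) = 1`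
  (`coe_cmCentreFinCharQuot_mk_relNormOneInfToIdeles`: TRIVIAL ARCHIMEDEAN TYPE);
* §3 rank one: on a hermitian LINE `J = diag(d)` the centre is everything (`adelicCenter_cmAdelicDet_line`: `(det g) · 1₁ = g`), so
  **`χ̃([♯det(1_∞, b)]) = ψ(b)`** for every `b ∈ U(⟨d⟩)(𝔸_{L⁺,f})` (`coe_cmCentreFinCharQuot_mk_cmAdelicDet_finAdelicToAdelic`) — the finite
  torus of the HodgeCM model's theta-distribution datum (`toIdele = finLineTorusIdeles = ♯det ∘ (1_∞, ·)`) sees exactly `ψ`.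

## Mathlib / tree search
Tree: `relNormOneIdeles`∕`relNormOneRat` (`RelNormOneTorus`), `relNormOneInfToIdeles`∕`relNormOneInfPart` (`RelNormOneTorusArch`∕`InfPart`),
`cmAdelicOneEquivRelNormOne` (`UnitaryGroupAdelicOneTorus`), `adelicCenter`∕`cm_adelicCenter_symm_mem_range_toAdelic`
(`UnitaryGroupAdelicCenter(Rational)`), `cmArchCenter`∕`archToAdelic_cmArchCenter` (`UnitaryGroupArchCenter`), `finPart`∕`finPart_archToAdelic`∕
`finPart_finAdelicToAdelic` (`UnitaryGroupAdelicProduct`), `cmAdelicDet` (`GelbartRogawski1991/UnitaryDualPairThetaKernelCMTwistDet`),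
`coe_eq_det_smul_one` (`UnitaryGroupAdelicLineTorus`, for `!![j]`; here for `Matrix.diagonal d`), the `PontryaginDual` descent pattern of
`Liu2021/Def411ChiAutomorphicQuotient.chiQuot` (quotient by `U(J_W)(F)` inside `U(J_W)(𝔸_F)`; here the quotient is the idèle-torus one).
Mathlib: `QuotientGroup.lift`, `QuotientGroup.isQuotientMap_mk`, `PontryaginDual`, `Circle`.

## References
* [Liu2021] Y. Liu, Camb. J. Math. 9 (2021) = arXiv:2102.11518, Def. 4.11 (l. 2090), proof of Prop. 4.13 (l. 2145).
* [Mok2014] C. P. Mok, Mem. AMS 235 (2015), §1 Notation p. 5 (centre of `U_{E/F}(N)` = `U_{E/F}(1)`).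
* [PlatonovRapinchuk1994] V. Platonov, A. Rapinchuk, *Algebraic Groups and Number Theory* (1994), §6.2.
* [BorelJacquet1979] A. Borel, H. Jacquet, Proc. Symp. Pure Math. 33 (1979), §4.1.
-/

set_option autoImplicit false

noncomputable section

open NumberField Topology
open Literature.NumberTheory.GelbartRogawski1991.UnitaryDualPair (CMAdelic CMAdelicOne CMCenter cmAdelicDet)

namespace Literature.NumberTheory.Automorphic.UnitaryGroup

variable (L : Type) [Field L] [NumberField L] [IsCMField L] (N : ℕ) (J : Matrix (Fin N) (Fin N) L)

/-! ## §1 The pull-back of a finite character through the centre -/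

section FinChar

variable {A : Type} [CommGroup A]
  (ψ : finAdelic (↥(maximalRealSubfield L)) L (IsCMField.complexConj L) N J →* A)

/-- **`t ↦ ψ((t · 1_N)_f)`**: the character of the norm-one idèle torus `ker N_{L/L⁺}(𝔸)` obtained from a character `ψ` of the
finite-adelic unitary group `U(J)(𝔸_{L⁺,f})` through the centre `t ↦ t · 1_N` and the finite component.
[cite: Mok2014, §1 Notation p. 5] [cite: Liu2021, Def. 4.11 (l. 2090)] -/
def cmCentreFinChar : ↥(relNormOneIdeles (↥(maximalRealSubfield L)) L) →* A :=
  ψ.comp ((finPart (↥(maximalRealSubfield L)) L (IsCMField.complexConj L) N J).comp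
    ((adelicCenter (↥(maximalRealSubfield L)) L (IsCMField.complexConj L) N J).comp (cmAdelicOneEquivRelNormOne L).symm.toMonoidHom))

/-- values (definitional). [cite: Mok2014, §1 Notation p. 5] -/
theorem cmCentreFinChar_apply (t : ↥(relNormOneIdeles (↥(maximalRealSubfield L)) L)) :
    cmCentreFinChar L N J ψ t =
      ψ (finPart (↥(maximalRealSubfield L)) L (IsCMField.complexConj L) N J
        (adelicCenter (↥(maximalRealSubfield L)) L (IsCMField.complexConj L) N J ((cmAdelicOneEquivRelNormOne L).symm t))) :=
  rfl

/-- **trivial archimedean type**: `cmCentreFinChar ψ (y, 1) = 1` — the centre at an archimedean torus element is archimedean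
(★ `archToAdelic_cmArchCenter`) and has finite part `1`. [cite: BorelJacquet1979, §4.1] -/
@[simp] theorem cmCentreFinChar_relNormOneInfToIdeles (y : ↥(relNormOneInfUnits (↥(maximalRealSubfield L)) L)) :
    cmCentreFinChar L N J ψ (relNormOneInfToIdeles (↥(maximalRealSubfield L)) L y) = 1 := by
  rw [cmCentreFinChar_apply, ← archToAdelic_cmArchCenter, finPart_archToAdelic, map_one]

/-- **rational triviality**: if `ψ` kills the finite parts of the rational points `U(J)(L⁺)` then `cmCentreFinChar ψ` kills
`L¹ = relNormOneRat` (the centre of a principal norm-one idèle is rational, ★ `cm_adelicCenter_symm_mem_range_toAdelic`).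
[cite: PlatonovRapinchuk1994, §6.2] [cite: Liu2021, Def. 4.11 (l. 2090)] -/
theorem cmCentreFinChar_eq_one_of_mem_relNormOneRat
    (hψ : ∀ g ∈ (toAdelic (↥(maximalRealSubfield L)) L (IsCMField.complexConj L) N J).range,
      ψ (finPart (↥(maximalRealSubfield L)) L (IsCMField.complexConj L) N J g) = 1)
    (t : ↥(relNormOneIdeles (↥(maximalRealSubfield L)) L)) (ht : t ∈ relNormOneRat (↥(maximalRealSubfield L)) L) :
    cmCentreFinChar L N J ψ t = 1 :=
  hψ _ (cm_adelicCenter_symm_mem_range_toAdelic L N J t ht)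

/-- kernel form of `cmCentreFinChar_eq_one_of_mem_relNormOneRat`. [cite: PlatonovRapinchuk1994, §6.2] -/
theorem relNormOneRat_le_ker_cmCentreFinChar
    (hψ : ∀ g ∈ (toAdelic (↥(maximalRealSubfield L)) L (IsCMField.complexConj L) N J).range,
      ψ (finPart (↥(maximalRealSubfield L)) L (IsCMField.complexConj L) N J g) = 1) :
    relNormOneRat (↥(maximalRealSubfield L)) L ≤ (cmCentreFinChar L N J ψ).ker := fun t ht =>
  cmCentreFinChar_eq_one_of_mem_relNormOneRat L N J ψ hψ t ht

end FinChar

/-- **continuity**: `t ↦ ψ((t · 1_N)_f)` is continuous (into `ℂ`) when `ψ` is (the currency change, the centre and the finite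
component are continuous). [cite: BorelJacquet1979, §4.1] -/
theorem continuous_cmCentreFinChar (ψ : finAdelic (↥(maximalRealSubfield L)) L (IsCMField.complexConj L) N J →* ℂˣ)
    (hψc : Continuous fun b => ((ψ b : ℂˣ) : ℂ)) :
    Continuous fun t => ((cmCentreFinChar L N J ψ t : ℂˣ) : ℂ) := by
  -- `(cmAdelicOneEquivRelNormOne L).symm` is continuous: same underlying idèles, both topologies induced from `𝔸_Lˣ`
  -- (★ `UnitaryDualPair.continuous_cmAdelicOneEquivRelNormOne_symm`)
  have h1 : Continuous (cmAdelicOneEquivRelNormOne L).symm := continuous_induced_rng.2 continuous_subtype_val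
  -- the centre `u ↦ u · 1_N` is continuous (★ `UnitaryDualPair.continuous_adelicCenter`)
  have h2 : Continuous (adelicCenter (↥(maximalRealSubfield L)) L (IsCMField.complexConj L) N J) := by
    have h : Continuous fun u : ↥(adelicOne (↥(maximalRealSubfield L)) L (IsCMField.complexConj L)) =>
        Units.map ((Matrix.scalar (Fin N) : AdeleRing (𝓞 L) L →+* Matrix (Fin N) (Fin N) (AdeleRing (𝓞 L) L)) :
            AdeleRing (𝓞 L) L →* Matrix (Fin N) (Fin N) (AdeleRing (𝓞 L) L)) (u : (AdeleRing (𝓞 L) L)ˣ) :=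
      (Continuous.units_map _ ((continuous_pi fun _ => continuous_id).matrix_diagonal)).comp continuous_subtype_val
    exact continuous_induced_rng.2 h
  exact hψc.comp ((continuous_finPart _ L _ N J).comp (h2.comp h1))

/-! ## §2 The descended character of `[U(1)] = ker N_{L/L⁺}(𝔸) ⧸ L¹` -/

section Quot

variable (ψ : finAdelic (↥(maximalRealSubfield L)) L (IsCMField.complexConj L) N J →* ℂˣ)
  (hψc : Continuous fun b => ((ψ b : ℂˣ) : ℂ)) (hψ1 : ∀ b, ‖((ψ b : ℂˣ) : ℂ)‖ = 1)
  (hψ : ∀ g ∈ (toAdelic (↥(maximalRealSubfield L)) L (IsCMField.complexConj L) N J).range,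
    ψ (finPart (↥(maximalRealSubfield L)) L (IsCMField.complexConj L) N J g) = 1)

/-- **`χ̃ ∈ PontryaginDual [U(1)]`** — the continuous unitary character of `ker N_{L/L⁺}(𝔸) ⧸ L¹` descended from `cmCentreFinChar ψ`, for
`ψ` continuous, unitary and trivial on (the finite parts of) `U(J)(L⁺)`: finite component `ψ ∘ (centre)`, TRIVIAL archimedean component.
[cite: Liu2021, Def. 4.11 (l. 2090); proof of Prop. 4.13 (l. 2145)] -/
def cmCentreFinCharQuot :
    PontryaginDual (↥(relNormOneIdeles (↥(maximalRealSubfield L)) L) ⧸ relNormOneRat (↥(maximalRealSubfield L)) L) where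
  toFun q := ⟨((QuotientGroup.lift _ (cmCentreFinChar L N J ψ) (relNormOneRat_le_ker_cmCentreFinChar L N J ψ hψ) q : ℂˣ) : ℂ),
    mem_sphere_zero_iff_norm.2 (by
      induction q using QuotientGroup.induction_on with
      | H t => rw [QuotientGroup.lift_mk]; exact hψ1 _)⟩
  map_one' := Circle.ext (by
    change ((QuotientGroup.lift _ (cmCentreFinChar L N J ψ) _ 1 : ℂˣ) : ℂ) = ((1 : Circle) : ℂ)
    rw [map_one, Units.val_one, Circle.coe_one])
  map_mul' p q := Circle.ext (by
    change ((QuotientGroup.lift _ (cmCentreFinChar L N J ψ) _ (p * q) : ℂˣ) : ℂ) =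
      ((QuotientGroup.lift _ (cmCentreFinChar L N J ψ) _ p : ℂˣ) : ℂ) * ((QuotientGroup.lift _ (cmCentreFinChar L N J ψ) _ q : ℂˣ) : ℂ)
    rw [map_mul, Units.val_mul])
  continuous_toFun := by
    refine Continuous.subtype_mk ?_ _
    refine (QuotientGroup.isQuotientMap_mk _).continuous_iff.2 ?_
    exact continuous_cmCentreFinChar L N J ψ hψc

/-- **`χ̃([t]) = ψ((t · 1_N)_f)`**, values in `ℂ`. [cite: Liu2021, Def. 4.11 (l. 2090)] -/
@[simp] theorem coe_cmCentreFinCharQuot_mk (t : ↥(relNormOneIdeles (↥(maximalRealSubfield L)) L)) :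
    ((cmCentreFinCharQuot L N J ψ hψc hψ1 hψ (QuotientGroup.mk t) : Circle) : ℂ) =
      ((ψ (finPart (↥(maximalRealSubfield L)) L (IsCMField.complexConj L) N J
        (adelicCenter (↥(maximalRealSubfield L)) L (IsCMField.complexConj L) N J ((cmAdelicOneEquivRelNormOne L).symm t))) : ℂˣ) : ℂ) :=
  rfl

/-- `χ̃([t]) = cmCentreFinChar ψ t` in `ℂˣ`. [cite: Liu2021, Def. 4.11 (l. 2090)] -/
theorem toUnits_cmCentreFinCharQuot_mk (t : ↥(relNormOneIdeles (↥(maximalRealSubfield L)) L)) :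
    Circle.toUnits (cmCentreFinCharQuot L N J ψ hψc hψ1 hψ (QuotientGroup.mk t)) = cmCentreFinChar L N J ψ t :=
  Units.ext rfl

/-- **TRIVIAL ARCHIMEDEAN TYPE** (in `ℂ`): `χ̃([(y, 1)]) = 1`. [cite: BorelJacquet1979, §4.1] [cite: Liu2021, Def. 4.11 (l. 2090)] -/
theorem coe_cmCentreFinCharQuot_mk_relNormOneInfToIdeles (y : ↥(relNormOneInfUnits (↥(maximalRealSubfield L)) L)) :
    ((cmCentreFinCharQuot L N J ψ hψc hψ1 hψ (QuotientGroup.mk (relNormOneInfToIdeles (↥(maximalRealSubfield L)) L y)) : Circle) : ℂ) = 1 := by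
  rw [coe_cmCentreFinCharQuot_mk, ← archToAdelic_cmArchCenter, finPart_archToAdelic, map_one, Units.val_one]

/-- **TRIVIAL ARCHIMEDEAN TYPE**: `χ̃([(y, 1)]) = 1`. [cite: BorelJacquet1979, §4.1] [cite: Liu2021, Def. 4.11 (l. 2090)] -/
@[simp] theorem cmCentreFinCharQuot_mk_relNormOneInfToIdeles (y : ↥(relNormOneInfUnits (↥(maximalRealSubfield L)) L)) :
    cmCentreFinCharQuot L N J ψ hψc hψ1 hψ (QuotientGroup.mk (relNormOneInfToIdeles (↥(maximalRealSubfield L)) L y)) = 1 :=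
  Circle.ext (by rw [coe_cmCentreFinCharQuot_mk_relNormOneInfToIdeles, Circle.coe_one])

/-- **the archimedean torus acts trivially**: `χ̃([(y,1) · t]) = χ̃([t])`. [cite: BorelJacquet1979, §4.1] -/
theorem cmCentreFinCharQuot_mk_relNormOneInfToIdeles_mul (y : ↥(relNormOneInfUnits (↥(maximalRealSubfield L)) L))
    (t : ↥(relNormOneIdeles (↥(maximalRealSubfield L)) L)) :
    cmCentreFinCharQuot L N J ψ hψc hψ1 hψ (QuotientGroup.mk (relNormOneInfToIdeles (↥(maximalRealSubfield L)) L y * t)) =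
      cmCentreFinCharQuot L N J ψ hψc hψ1 hψ (QuotientGroup.mk t) := by
  rw [QuotientGroup.mk_mul, map_mul, cmCentreFinCharQuot_mk_relNormOneInfToIdeles, one_mul]

/-- **`χ̃` only sees the finite component**: `χ̃([t]) = χ̃([t'])` whenever `(t · 1_N)_f = (t' · 1_N)_f`. [cite: Liu2021, Def. 4.11 (l. 2090)] -/
theorem cmCentreFinCharQuot_mk_eq_of_finPart_eq (t t' : ↥(relNormOneIdeles (↥(maximalRealSubfield L)) L))
    (h : finPart (↥(maximalRealSubfield L)) L (IsCMField.complexConj L) N J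
        (adelicCenter (↥(maximalRealSubfield L)) L (IsCMField.complexConj L) N J ((cmAdelicOneEquivRelNormOne L).symm t)) =
      finPart (↥(maximalRealSubfield L)) L (IsCMField.complexConj L) N J
        (adelicCenter (↥(maximalRealSubfield L)) L (IsCMField.complexConj L) N J ((cmAdelicOneEquivRelNormOne L).symm t'))) :
    cmCentreFinCharQuot L N J ψ hψc hψ1 hψ (QuotientGroup.mk t) = cmCentreFinCharQuot L N J ψ hψc hψ1 hψ (QuotientGroup.mk t') :=
  Circle.ext (by rw [coe_cmCentreFinCharQuot_mk, coe_cmCentreFinCharQuot_mk, h])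

end Quot

/-! ## §3 Rank one: the centre of a hermitian line is everything -/

section Line

variable (d : Fin 1 → L) (hd0 : ∀ i, d i ≠ 0)

/-- **`(det g) · 1₁ = g`** in `U(⟨d⟩)(𝔸_{L⁺})`: a `1 × 1` unitary matrix is central (★ `coe_eq_det_smul_one`). [cite: Mok2014, §1 Notation p. 5] -/
theorem adelicCenter_cmAdelicDet_line (g : CMAdelic L d) : CMCenter L d (cmAdelicDet L d hd0 g) = g :=
  Subtype.ext (Units.ext
    ((coe_adelicCenter (↥(maximalRealSubfield L)) L (IsCMField.complexConj L) 1 (Matrix.diagonal d) _).trans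
      (coe_eq_det_smul_one L _).symm))

/-- finite part of the centre at `♯det(1_∞, b)`: **`((♯det(1_∞, b)) · 1₁)_f = b`**. [cite: Mok2014, §1 Notation p. 5] -/
theorem finPart_adelicCenter_symm_cmAdelicDet_finAdelicToAdelic
    (b : finAdelic (↥(maximalRealSubfield L)) L (IsCMField.complexConj L) 1 (Matrix.diagonal d)) :
    finPart (↥(maximalRealSubfield L)) L (IsCMField.complexConj L) 1 (Matrix.diagonal d)
        (adelicCenter (↥(maximalRealSubfield L)) L (IsCMField.complexConj L) 1 (Matrix.diagonal d)
          ((cmAdelicOneEquivRelNormOne L).symm (cmAdelicOneEquivRelNormOne L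
            (cmAdelicDet L d hd0 (finAdelicToAdelic (↥(maximalRealSubfield L)) L (IsCMField.complexConj L) 1 (Matrix.diagonal d) b))))) =
      b := by
  rw [MulEquiv.symm_apply_apply]
  exact (congrArg (finPart (↥(maximalRealSubfield L)) L (IsCMField.complexConj L) 1 (Matrix.diagonal d))
    (adelicCenter_cmAdelicDet_line L d hd0 _)).trans (finPart_finAdelicToAdelic _ L _ 1 _ b)

variable (ψ : finAdelic (↥(maximalRealSubfield L)) L (IsCMField.complexConj L) 1 (Matrix.diagonal d) →* ℂˣ)
  (hψc : Continuous fun b => ((ψ b : ℂˣ) : ℂ)) (hψ1 : ∀ b, ‖((ψ b : ℂˣ) : ℂ)‖ = 1)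
  (hψ : ∀ g ∈ (toAdelic (↥(maximalRealSubfield L)) L (IsCMField.complexConj L) 1 (Matrix.diagonal d)).range,
    ψ (finPart (↥(maximalRealSubfield L)) L (IsCMField.complexConj L) 1 (Matrix.diagonal d) g) = 1)

/-- on a line, `cmCentreFinChar ψ (♯det(1_∞, b)) = ψ b`. [cite: Liu2021, Def. 4.11 (l. 2090)] -/
theorem cmCentreFinChar_cmAdelicDet_finAdelicToAdelic {A : Type} [CommGroup A]
    (ψ : finAdelic (↥(maximalRealSubfield L)) L (IsCMField.complexConj L) 1 (Matrix.diagonal d) →* A)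
    (b : finAdelic (↥(maximalRealSubfield L)) L (IsCMField.complexConj L) 1 (Matrix.diagonal d)) :
    cmCentreFinChar L 1 (Matrix.diagonal d) ψ (cmAdelicOneEquivRelNormOne L
        (cmAdelicDet L d hd0 (finAdelicToAdelic (↥(maximalRealSubfield L)) L (IsCMField.complexConj L) 1 (Matrix.diagonal d) b))) =
      ψ b := by
  rw [cmCentreFinChar_apply, finPart_adelicCenter_symm_cmAdelicDet_finAdelicToAdelic]

/-- **RANK ONE: `χ̃([♯det(1_∞, b)]) = ψ(b)`** for every `b ∈ U(⟨d⟩)(𝔸_{L⁺,f})` — the finite torus of the theta-distribution datum of a line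
(`toIdele = ♯det ∘ (1_∞, ·)`) sees exactly `ψ`. [cite: Liu2021, Def. 4.11 (l. 2090); proof of Prop. 4.13 (l. 2145)] -/
theorem coe_cmCentreFinCharQuot_mk_cmAdelicDet_finAdelicToAdelic
    (b : finAdelic (↥(maximalRealSubfield L)) L (IsCMField.complexConj L) 1 (Matrix.diagonal d)) :
    ((cmCentreFinCharQuot L 1 (Matrix.diagonal d) ψ hψc hψ1 hψ (QuotientGroup.mk (cmAdelicOneEquivRelNormOne L
        (cmAdelicDet L d hd0 (finAdelicToAdelic (↥(maximalRealSubfield L)) L (IsCMField.complexConj L) 1 (Matrix.diagonal d) b)))) :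
        Circle) : ℂ) = ((ψ b : ℂˣ) : ℂ) := by
  rw [coe_cmCentreFinCharQuot_mk, finPart_adelicCenter_symm_cmAdelicDet_finAdelicToAdelic]

/-- the same for the INVERSE (the currency of `ThetaDistDatum.chiFin`: `u ↦ χ̃(toIdele u)⁻¹`): `χ̃([♯det(1_∞, b)])⁻¹ = ψ(b)⁻¹` in `ℂˣ`.
[cite: Liu2021, proof of Prop. 4.13 (l. 2145)] -/
theorem toUnits_cmCentreFinCharQuot_mk_cmAdelicDet_finAdelicToAdelic_inv
    (b : finAdelic (↥(maximalRealSubfield L)) L (IsCMField.complexConj L) 1 (Matrix.diagonal d)) :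
    Circle.toUnits ((cmCentreFinCharQuot L 1 (Matrix.diagonal d) ψ hψc hψ1 hψ (QuotientGroup.mk (cmAdelicOneEquivRelNormOne L
        (cmAdelicDet L d hd0 (finAdelicToAdelic (↥(maximalRealSubfield L)) L (IsCMField.complexConj L) 1 (Matrix.diagonal d) b)))))⁻¹) =
      (ψ b)⁻¹ := by
  rw [map_inv, toUnits_cmCentreFinCharQuot_mk, cmCentreFinChar_cmAdelicDet_finAdelicToAdelic]

end Line

end Literature.NumberTheory.Automorphic.UnitaryGroup

end
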